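import Summits.QuantumFields.YangMills.Theorems.BalabanUVNodesN18FactorLoopsLocalGauge
import Summits.QuantumFields.YangMills.Theorems.UnitScaleTiltProp8ChartLocality
import Summits.QuantumFields.YangMills.Theorems.BalabanUVNodesN18CombStepFirstOrderFrame
import HarnessLib

/-!
# BalabanUVNodes ∕ node N18 = NE5 — closure-ledger item (iii): THE TRANSPORTED PAIR IS `SL(N, ℂ)`-VALUED AT INTERIOR BONDS, FROM RUN B's CONDITIONS (i)–(iii) ALONE —
# the letter `hUGc` of the (T3) letter form DISCHARGED in the interior of the (1.12) cubes
# (Track A, DAG node N18 = `T4OutputRate.NE5` :211; cluster K4 «SpineRates», item K3⁷ `SpineGivenEndpointR13SepCoPH`; seat pub-ymgap-dag-n18-w3 g3)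

HONEST FRAMING.  Count-neutral kernel bookkeeping (`--supports stmt-QuantumFields-20544 --as helper`): composition of this seat's FILES 10–11 with UST's two-block
locality (`Prop8Chart.emlAvgU_congr₂`, `holT_loopWord_congr₂`) through the cutoff device (fields modified off the two blocks).  INTERIOR ONLY: the two blocks of the
coarse bond must lie in ONE (1.12) cube of run B's frame and inside its region; the smallness thresholds are displayed numerics.  Coarse bonds across cube faces ∕ at
the domain boundary are the located box-Stokes point ([DAGN18W3-G3-LOCATED-1]).  Nothing of Bałaban's RG asserted; NE5 NOT PRINTED ∕ NOT proved; N18 NOT discharged;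
nothing about the continuum ∕ OS ∕ mass gap ∕ Clay.

WHAT.
* ★★★ `avgUnits_mem_suModel_Gc_of_satisfiesI_III` — for a pair `Φ` satisfying (i)–(iii) (`suModel N`, any frame `FB`, constants `cB`, radii `α₀, α₁, γ₀`) and a coarse
  bond `c` whose two-block bonds are bonds of the region AND of one (1.12) cube `C ∈ FB.cubes`: `Ū(Φ.𝐔)(c) ∈ SL(N, ℂ)`, under the numerics `0 ≤ ξ`, `0 ≤ cB·α₀`, `0 ≤ α₁`,
  `ξ·cB·α₀ ≤ 1`, `8ℓξ·cB·α₀ ≤ 1`, `ξα₁ ≤ 1∕4`, and `r + ((1+2ε)^ℓ − 1) ≤ 1∕3`, `N·(r + ((1+2ε)^ℓ − 1)) < π` with `r = 8ℓξ·cB·α₀`, `ε = 2ξα₁` (`ℓ = (d+2)L`).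
* ★★★ `TΦOfRecord_U_mem_suModel_Gc_of_satisfiesI_III` — the same read through W1-18's transport of record at a run-A bond `b` (`c = bondShift b`): the letter `hUGc`
  of `exists_orbit_TΦOfRecord_of_letters_su` ∕ FILE 7's `hletters`, from run B's (i)–(iii) + geometry + numerics; `…_frameI` — at the frames of record, where a
  (1.12) cube containing the two-block bonds suffices (`cubesI_bonds_subset`).

0 `def`, 0 `sorry`.  References: T. Bałaban, CMP **109** (1987) 249–301 [Balaban1987RG1] ((0.4)–(0.5) p.253, (1.10)–(1.14) p.262); CMP **98** (1985) 17–51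
[Balaban1985Averaging] ((122)–(123) p.36).
-/

noncomputable section

open scoped BigOperators Matrix.Norms.L2Operator

namespace YMDAG.N18.TransportOfRecord

open Literature.MathematicalPhysics.QuantumFieldTheory.Balaban1983to89
open Literature.MathematicalPhysics.QuantumFieldTheory.Balaban1983to89.T4Continuum
open Literature.MathematicalPhysics.QuantumFieldTheory.Balaban1983to89.T4LevelShift
open Literature.MathematicalPhysics.QuantumFieldTheory.Balaban1983to89.BlockAveraging
open Literature.MathematicalPhysics.QuantumFieldTheory.Balaban1983to89.B12RegularSpaces111
open Literature.MathematicalPhysics.QuantumFieldTheory.Balaban1983to89.B12RegularSpaces111SpecialUnitary (suModel mem_suModel_Gc suModel_norm_le)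
open Literature.MathematicalPhysics.QuantumFieldTheory.Balaban1983to89.Node00 (MatA)
open Literature.MathematicalPhysics.QuantumFieldTheory.Balaban1983to89.Node00.W1
open Summit.QuantumFields.YangMills.Theorems.Prop8Chart (emlAvgU_congr₂ holT_loopWord_congr₂)

section Interior

variable {P : Params} {N : ℕ} [NeZero N]

/-- ★★★ **`Ū(𝐔)(c) ∈ SL(N, ℂ)` FROM (i)–(iii), INTERIOR CASE**.  From `SatisfiesI_III (suModel N) FB cB α₀ α₁ γ₀ Φ`: `𝐔 = (exp iξA′)·U` everywhere, `𝐔`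
`SL`-valued and `|A′| < α₁` on the region's bonds, `U` `SU(N)`-valued there with (1.12) on the cubes; if the fine bonds with both ends in the two blocks of `c` are bonds
of the region and of ONE cube `C ∈ FB.cubes`, the loops of `U` at `c` are within `r = 8ℓξ·cB·α₀` of `1` (FILE 11), the chart factors within `ε = 2ξα₁`, and FILE 10's
`avgUnits_mem_suModel_Gc_of_factors` applies to the fields CUT OFF to `1` off the two blocks (which have the same `Ū(c)`, UST `emlAvgU_congr₂`).
[cite: Balaban1987RG1, before (0.5) p.253, (1.10)-(1.14) p.262] -/
theorem avgUnits_mem_suModel_Gc_of_satisfiesI_III (hj : 0 + 1 ≤ P.m + P.K) {FB : Frame P 0 (MatA N)} {cB : StepConsts} {α₀ α₁ γ₀ : ℝ}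
    {Φ : FieldPair P 0 (MatA N)ˣ (MatA N)} (hsat : SatisfiesI_III (suModel N) FB cB α₀ α₁ γ₀ Φ) (c : PBond P 1)
    (hXb : ∀ b : PBond P 0, (blockOf b.src = c.src ∨ blockOf b.src = c.tgt) → (blockOf b.tgt = c.src ∨ blockOf b.tgt = c.tgt) → b ∈ FB.X.bonds)
    {C : Region P 0} (hC : C ∈ FB.cubes)
    (h2b : ∀ b : PBond P 0, (blockOf b.src = c.src ∨ blockOf b.src = c.tgt) → (blockOf b.tgt = c.src ∨ blockOf b.tgt = c.tgt) → b ∈ C.bonds)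
    (hξ : 0 ≤ cB.ξ) (hα : 0 ≤ cB.cB * α₀) (hα₁ : 0 ≤ α₁) (hξα : cB.ξ * (cB.cB * α₀) ≤ 1)
    (hℓ : 8 * (((P.d + 2) * P.L : ℕ) : ℝ) * (cB.ξ * (cB.cB * α₀)) ≤ 1) (hξ₁ : cB.ξ * α₁ ≤ 1 / 4)
    (h3 : 8 * (((P.d + 2) * P.L : ℕ) : ℝ) * (cB.ξ * (cB.cB * α₀)) + ((1 + 2 * (2 * (cB.ξ * α₁))) ^ ((P.d + 2) * P.L) - 1) ≤ 1 / 3)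
    (hπ : (N : ℝ) * (8 * (((P.d + 2) * P.L : ℕ) : ℝ) * (cB.ξ * (cB.cB * α₀)) + ((1 + 2 * (2 * (cB.ξ * α₁))) ^ ((P.d + 2) * P.L) - 1)) < Real.pi) :
    avgUnits Φ.U c ∈ (suModel N).Gc := by
  classical
  obtain ⟨hUGc, -, U, A', hf, hI, hII, -⟩ := hsat
  -- the two-block predicate and the cut-off fields
  let χ : PBond P 0 → Prop := fun b => (blockOf b.src = c.src ∨ blockOf b.src = c.tgt) ∧ (blockOf b.tgt = c.src ∨ blockOf b.tgt = c.tgt)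
  let Uc' : GaugeField P 0 (MatA N)ˣ := fun b => if χ b then Φ.U b else 1
  let U' : GaugeField P 0 (MatA N)ˣ := fun b => if χ b then U b else 1
  let e' : GaugeField P 0 (MatA N)ˣ := fun b => if χ b then expI cB.ξ (A' b) else 1
  have hagree : ∀ b : PBond P 0, (blockOf b.src = c.src ∨ blockOf b.src = c.tgt) → (blockOf b.tgt = c.src ∨ blockOf b.tgt = c.tgt) →
      Φ.U b = Uc' b := fun b h1 h2 => by simp only [Uc', χ, if_pos (And.intro h1 h2)]
  have hagreeU : ∀ b : PBond P 0, (blockOf b.src = c.src ∨ blockOf b.src = c.tgt) → (blockOf b.tgt = c.src ∨ blockOf b.tgt = c.tgt) →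
      U b = U' b := fun b h1 h2 => by simp only [U', χ, if_pos (And.intro h1 h2)]
  -- the factorisation and the letters of the cut-off fields
  have hf' : ∀ b, Uc' b = e' b * U' b := fun b => by
    by_cases hb : χ b
    · simp only [Uc', U', e', if_pos hb]; exact hf b
    · simp only [Uc', U', e', if_neg hb, one_mul]
  have hUc' : ∀ b, Uc' b ∈ (suModel N).Gc := fun b => by
    by_cases hb : χ b
    · simp only [Uc', if_pos hb]; exact hUGc b (hXb b hb.1 hb.2)
    · simp only [Uc', if_neg hb]; exact (suModel N).Gc.one_mem
  have hU'1 : ∀ b, ‖((U' b : (MatA N)ˣ) : MatA N)‖ ≤ 1 := fun b => by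
    by_cases hb : χ b
    · simp only [U', if_pos hb]; exact suModel_norm_le _ (hI.gValued b (hXb b hb.1 hb.2))
    · simp only [U', if_neg hb, Units.val_one, norm_one]; exact le_rfl
  have hU'2 : ∀ b, ‖(((U' b)⁻¹ : (MatA N)ˣ) : MatA N)‖ ≤ 1 := fun b => by
    by_cases hb : χ b
    · simp only [U', if_pos hb]; exact suModel_norm_le _ ((suModel N).G.inv_mem (hI.gValued b (hXb b hb.1 hb.2)))
    · simp only [U', if_neg hb, inv_one, Units.val_one, norm_one]; exact le_rfl
  have hε : 2 * (cB.ξ * α₁) ≤ 1 / 2 := by linarith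
  have he' : ∀ b, ‖((e' b : (MatA N)ˣ) : MatA N) - 1‖ ≤ 2 * (cB.ξ * α₁) := fun b => by
    by_cases hb : χ b
    · simp only [e', if_pos hb]
      have hA : ‖A' b‖ ≤ α₁ := (hII.norm_lt b (hXb b hb.1 hb.2)).le
      have h1 : cB.ξ * ‖A' b‖ ≤ cB.ξ * α₁ := mul_le_mul_of_nonneg_left hA hξ
      exact (norm_coe_expI_sub_one_le hξ (h1.trans (by linarith))).trans (by linarith)
    · simp only [e', if_neg hb, Units.val_one, sub_self, norm_zero]
      exact mul_nonneg zero_le_two (mul_nonneg hξ hα₁)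
  -- the loops of the cut-off factor = the loops of the factor, small by FILE 11
  have hr : ∀ i : Idx P, ‖((loopVarU U' c i : (MatA N)ˣ) : MatA N) - 1‖ ≤ 8 * (((P.d + 2) * P.L : ℕ) : ℝ) * (cB.ξ * (cB.cB * α₀)) := fun i => by
    have hloop : loopVarU U' c i = loopVarU U c i := (holT_loopWord_congr₂ hj c hagreeU i).symm
    rw [hloop]
    exact norm_loopVarU_sub_one_le_of_condI suModel_norm_le hj hI hξ hα hξα c hℓ hC h2b i
  -- assemble on the cut-off fields, then return to `Φ.𝐔` by two-block locality
  have hmem := avgUnits_mem_suModel_Gc_of_factors hf' hUc' hU'1 hU'2 hε he' c hr h3 hπ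
  have heq : avgUnits Φ.U c = avgUnits Uc' c := emlAvgU_congr₂ hj c hagree
  rw [heq]
  exact hmem

end Interior

section Record

variable {F : T4Family} {N k : ℕ} [NeZero N]

/-- ★★★ **THE LETTER `hUGc` FROM RUN B's (i)–(iii), INTERIOR CASE, FOR THE TRANSPORT OF RECORD**: at a run-A bond `b` whose coarse bond `c = bondShift b` has its two
blocks inside run B's region and inside one (1.12) cube, `(TΦOfRecord F N k Φ).U b ∈ SL(N, ℂ)` for every `Φ` satisfying (i)–(iii) of run B (numerics displayed).
[cite: Balaban1987RG1, before (0.5) p.253, (1.10)-(1.14) p.262] -/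
theorem TΦOfRecord_U_mem_suModel_Gc_of_satisfiesI_III {FB : Frame (F.P (k + 1)) 0 (MatA N)} {cB : StepConsts} {α₀ α₁ γ₀ : ℝ}
    {Φ : FieldPair (F.P (k + 1)) 0 (MatA N)ˣ (MatA N)} (hsat : SatisfiesI_III (suModel N) FB cB α₀ α₁ γ₀ Φ) (b : PBond (F.P k) 0)
    (hXb : ∀ b' : PBond (F.P (k + 1)) 0,
      (blockOf b'.src = (bondShift (sitesPerDir_ladder F (K := k) (j := 0) rfl rfl) b).src ∨
          blockOf b'.src = (bondShift (sitesPerDir_ladder F (K := k) (j := 0) rfl rfl) b).tgt) →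
        (blockOf b'.tgt = (bondShift (sitesPerDir_ladder F (K := k) (j := 0) rfl rfl) b).src ∨
          blockOf b'.tgt = (bondShift (sitesPerDir_ladder F (K := k) (j := 0) rfl rfl) b).tgt) → b' ∈ FB.X.bonds)
    {C : Region (F.P (k + 1)) 0} (hC : C ∈ FB.cubes)
    (h2b : ∀ b' : PBond (F.P (k + 1)) 0,
      (blockOf b'.src = (bondShift (sitesPerDir_ladder F (K := k) (j := 0) rfl rfl) b).src ∨
          blockOf b'.src = (bondShift (sitesPerDir_ladder F (K := k) (j := 0) rfl rfl) b).tgt) →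
        (blockOf b'.tgt = (bondShift (sitesPerDir_ladder F (K := k) (j := 0) rfl rfl) b).src ∨
          blockOf b'.tgt = (bondShift (sitesPerDir_ladder F (K := k) (j := 0) rfl rfl) b).tgt) → b' ∈ C.bonds)
    (hξ : 0 ≤ cB.ξ) (hα : 0 ≤ cB.cB * α₀) (hα₁ : 0 ≤ α₁) (hξα : cB.ξ * (cB.cB * α₀) ≤ 1)
    (hℓ : 8 * ((((F.P (k + 1)).d + 2) * (F.P (k + 1)).L : ℕ) : ℝ) * (cB.ξ * (cB.cB * α₀)) ≤ 1) (hξ₁ : cB.ξ * α₁ ≤ 1 / 4)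
    (h3 : 8 * ((((F.P (k + 1)).d + 2) * (F.P (k + 1)).L : ℕ) : ℝ) * (cB.ξ * (cB.cB * α₀)) +
        ((1 + 2 * (2 * (cB.ξ * α₁))) ^ (((F.P (k + 1)).d + 2) * (F.P (k + 1)).L) - 1) ≤ 1 / 3)
    (hπ : (N : ℝ) * (8 * ((((F.P (k + 1)).d + 2) * (F.P (k + 1)).L : ℕ) : ℝ) * (cB.ξ * (cB.cB * α₀)) +
        ((1 + 2 * (2 * (cB.ξ * α₁))) ^ (((F.P (k + 1)).d + 2) * (F.P (k + 1)).L) - 1)) < Real.pi) :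
    (TΦOfRecord F N k Φ).U b ∈ (suModel N).Gc := by
  rw [TΦOfRecord_U]
  exact avgUnits_mem_suModel_Gc_of_satisfiesI_III (by simp only [T4Family.P_m, T4Family.P_K]; omega) hsat _ hXb hC h2b hξ hα hα₁ hξα hℓ hξ₁ h3 hπ

/-- ★★★ **THE SAME AT THE FRAMES OF RECORD** `frameI Rz M j' Y'` of run B: a (1.12) cube of the frame containing the two-block bonds suffices (its bonds are bonds of the
region, `YMDAG.N18.CombStep.cubesI_bonds_subset`). [cite: Balaban1987RG1, before (0.5) p.253, (1.10)-(1.14) p.262] -/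
theorem TΦOfRecord_U_mem_suModel_Gc_of_satisfiesI_III_frameI (Rz : Node00.Sect2.Residual (F.P (k + 1)) (MatA N)) (M j' : ℕ)
    (Y' : Set (Site (F.P (k + 1)) 0)) {cB : StepConsts} {α₀ α₁ γ₀ : ℝ}
    {Φ : FieldPair (F.P (k + 1)) 0 (MatA N)ˣ (MatA N)} (hsat : SatisfiesI_III (suModel N) (Node00.Sect2.frameI Rz M j' Y') cB α₀ α₁ γ₀ Φ)
    (b : PBond (F.P k) 0) {C : Region (F.P (k + 1)) 0} (hC : C ∈ (Node00.Sect2.frameI Rz M j' Y').cubes)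
    (h2b : ∀ b' : PBond (F.P (k + 1)) 0,
      (blockOf b'.src = (bondShift (sitesPerDir_ladder F (K := k) (j := 0) rfl rfl) b).src ∨
          blockOf b'.src = (bondShift (sitesPerDir_ladder F (K := k) (j := 0) rfl rfl) b).tgt) →
        (blockOf b'.tgt = (bondShift (sitesPerDir_ladder F (K := k) (j := 0) rfl rfl) b).src ∨
          blockOf b'.tgt = (bondShift (sitesPerDir_ladder F (K := k) (j := 0) rfl rfl) b).tgt) → b' ∈ C.bonds)
    (hξ : 0 ≤ cB.ξ) (hα : 0 ≤ cB.cB * α₀) (hα₁ : 0 ≤ α₁) (hξα : cB.ξ * (cB.cB * α₀) ≤ 1)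
    (hℓ : 8 * ((((F.P (k + 1)).d + 2) * (F.P (k + 1)).L : ℕ) : ℝ) * (cB.ξ * (cB.cB * α₀)) ≤ 1) (hξ₁ : cB.ξ * α₁ ≤ 1 / 4)
    (h3 : 8 * ((((F.P (k + 1)).d + 2) * (F.P (k + 1)).L : ℕ) : ℝ) * (cB.ξ * (cB.cB * α₀)) +
        ((1 + 2 * (2 * (cB.ξ * α₁))) ^ (((F.P (k + 1)).d + 2) * (F.P (k + 1)).L) - 1) ≤ 1 / 3)
    (hπ : (N : ℝ) * (8 * ((((F.P (k + 1)).d + 2) * (F.P (k + 1)).L : ℕ) : ℝ) * (cB.ξ * (cB.cB * α₀)) +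
        ((1 + 2 * (2 * (cB.ξ * α₁))) ^ (((F.P (k + 1)).d + 2) * (F.P (k + 1)).L) - 1)) < Real.pi) :
    (TΦOfRecord F N k Φ).U b ∈ (suModel N).Gc :=
  TΦOfRecord_U_mem_suModel_Gc_of_satisfiesI_III hsat b (fun b' h1 h2 => YMDAG.N18.CombStep.cubesI_bonds_subset hC (h2b b' h1 h2)) hC h2b
    hξ hα hα₁ hξα hℓ hξ₁ h3 hπ

end Record

end YMDAG.N18.TransportOfRecord

end
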